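import Literature.NumberTheory.Automorphic.LangAutomorphicFormsAdmissibleProofs
import Literature.NumberTheory.Automorphic.LangAutomorphicFormsProofs
import Literature.NumberTheory.Automorphic.AutomorphicFormsStableGLHolds
import HarnessLib

/-!
# Harish-Chandra's finiteness theorem for `GL_n(𝔸_K)`: the ideal form follows from the character form
# (`harishChandra_finiteness hcpt ↔ harishChandra_finiteness_gl hcpt`)

Topic `NumberTheory/Automorphic`; sibling proof file of `LangAutomorphicForms` and `AutomorphicRepsGL`.
The tree states Harish-Chandra's finiteness theorem for `GL_n` over a number field `K`
(Borel–Jacquet, Corvallis 1979, 4.3 (i); Harish-Chandra, LNM 62 (1968), Thm. 1) as two named facts: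
the **ideal form** `harishChandra_finiteness hcpt` of `LangAutomorphicForms` (automorphic forms of
level `U` annihilated by an ideal `J ≤ Z(𝔤)` of finite codimension, with `K_∞`-slices in a fixed
finite-dimensional right-`K_∞`-stable `M`, span a finite-dimensional space) and the **character
form** `harishChandra_finiteness_gl hcpt` of `AutomorphicRepsGL` (the same with "`Z(𝔤)` acts through
the character `θ`" in place of "killed by `J`"). `LangAutomorphicFormsProofs` proves ideal ⇒ character
(`harishChandra_finiteness_gl_of_harishChandra_finiteness`: `J = ker θ` has codimension `≤ 2`). This
file proves the converse, so that **the two named facts are equivalent**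
(`harishChandra_finiteness_iff_harishChandra_finiteness_gl`) and a discharge of either discharges
both (and, through `LangAutomorphicFormsAdmissibleProofs`, Borel–Jacquet 4.5). In print the passage
is Harish-Chandra's (LNM 62, §2): `Z(𝔤) ⧸ J` is a finite-dimensional commutative algebra, so a
`Z(𝔤)`-stable space killed by `J` is the sum of finitely many generalised eigenspaces, each filtered
by eigenspaces (character subspaces).

* §1 `span_range_eval_eq_top` — the evaluation functionals span the dual of a finite-dimensional
  space of functions (reflexivity); hence every linear functional on the span of the
  `K_∞`-translates of a `K_∞`-finite `φ` is a finite combination of evaluations.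
* §2 `slice_applyFree_mem_of_isCentralWord` — **the `K_∞`-slices of `z φ`, `z` a central word, lie in
  any space `M` containing the `K_∞`-slices of the `K_∞`-finite smooth `φ`**: `z` commutes with the
  right `K_∞`-translations (`applyFree_archTranslate_of_isCentralWord`), so the slice of `z φ` at `g`
  is `k ↦ Λ_g(r(k) φ)` for the linear functional `Λ_g = (ψ ↦ (z ψ)(g))` on the span of the
  `K_∞`-translates of `φ`, a finite combination of evaluations `ψ ↦ ψ(xᵢ)` (§1), and
  `k ↦ (r(k) φ)(xᵢ)` is the slice of `φ` at `xᵢ`.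
* §3 `harishChandra_finiteness_of_harishChandra_finiteness_gl` (**main**) and
  `harishChandra_finiteness_iff_harishChandra_finiteness_gl`. Mechanism: inside the smooth functions
  `E = archSmooth`, on which `U(𝔤)` acts (`lieDerivRep`, `envelopingAction`), the span `F` of the
  spanning set of the ideal form is stable under `Z(𝔤)` (§2 for the slices; Borel–Jacquet 4.3 (ii),
  proved in the tree, for automorphy; central words commute for the annihilation by `J`) and killed
  by `J`; every subspace of `F` on which `Z(𝔤)` acts through a character `θ` lies in the span of the
  spanning set of the character form for `θ`, finite-dimensional by hypothesis; the generic
  `finiteDimensional_of_forall_character` (`LangAutomorphicFormsAdmissibleProofs`, §11: lift a basis of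
  `Z(𝔤) ⧸ J` to commuting algebraic operators and decompose into joint eigenspaces) concludes.

Everything here is proved; there are no definitions and no named facts.

## References

* A. Borel, H. Jacquet, *Automorphic forms and automorphic representations*, Proc. Sympos. Pure
  Math. 33.1 (Corvallis 1979), 189–202, 4.3 (i)–(ii) [BorelJacquet1979].
* Harish-Chandra, *Automorphic forms on semisimple Lie groups*, LNM 62 (1968), §2, Thm. 1.
-/

noncomputable section

open scoped MatrixGroups Matrix ContDiff Classical
open NumberField NumberField.mixedEmbedding IsDedekindDomain

namespace Literature.NumberTheory.Automorphic

/-! ### 1. Evaluation functionals span the dual of a finite-dimensional space of functions -/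

section Eval

variable {X : Type*}

/-- **The evaluations span the dual of a finite-dimensional space of functions.** For a
finite-dimensional subspace `W` of the functions `X → ℂ`, the functionals `ψ ↦ ψ(x)`, `x ∈ X`, span
the dual space of `W`: a functional on the dual killing all evaluations is (reflexivity) the
evaluation at some `w ∈ W` with `w(x) = 0` for all `x`, i.e. `w = 0`. [folklore] -/
theorem span_range_eval_eq_top (W : Submodule ℂ (X → ℂ)) [FiniteDimensional ℂ W] :
    Submodule.span ℂ (Set.range fun x : X =>
      ((LinearMap.proj x).comp W.subtype : Module.Dual ℂ W)) = ⊤ := by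
  by_contra hne
  obtain ⟨f, hf0, hle⟩ := Submodule.exists_le_ker_of_lt_top _ (lt_top_iff_ne_top.2 hne)
  obtain ⟨w, rfl⟩ := (Module.bijective_dual_eval ℂ W).2 f
  have hw : ∀ x : X, (w : X → ℂ) x = 0 := fun x => by
    have hx : ((LinearMap.proj x).comp W.subtype : Module.Dual ℂ W) ∈
        LinearMap.ker (Module.Dual.eval ℂ W w) := hle (Submodule.subset_span ⟨x, rfl⟩)
    simpa [LinearMap.mem_ker, Module.Dual.eval_apply] using hx
  have hw0 : w = 0 := Subtype.ext (funext hw)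
  exact hf0 (by rw [hw0, map_zero])

/-- Hence every linear functional on a finite-dimensional space `W` of functions is a finite linear
combination of evaluations: `Λ = ∑ᵢ cᵢ ev_{xᵢ}` for a finitely supported `c : X →₀ ℂ`. [folklore] -/
theorem exists_finsupp_eval_eq (W : Submodule ℂ (X → ℂ)) [FiniteDimensional ℂ W] (Λ : Module.Dual ℂ W) :
    ∃ c : X →₀ ℂ, ∀ ψ : W, Λ ψ = c.sum fun x a => a * (ψ : X → ℂ) x := by
  have hΛ : Λ ∈ Submodule.span ℂ (Set.range fun x : X =>
      ((LinearMap.proj x).comp W.subtype : Module.Dual ℂ W)) := by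
    rw [span_range_eval_eq_top W]
    exact Submodule.mem_top
  obtain ⟨c, hc⟩ := Finsupp.mem_span_range_iff_exists_finsupp.1 hΛ
  refine ⟨c, fun ψ => ?_⟩
  rw [← hc, Finsupp.sum, LinearMap.sum_apply, Finsupp.sum]
  refine Finset.sum_congr rfl fun x _ => ?_
  rw [LinearMap.smul_apply, smul_eq_mul]
  rfl

end Eval

/-! ### 2. Slices of `z φ`, `z` central, stay in any space containing the slices of `φ` -/

section Slices

variable {n : ℕ} {K : Type} [Field K] [NumberField K] {hcpt : isCompact_glFiniteIntegralLevel n K}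

-- the scoped operator norm on `𝔤𝔩_n(K_∞)`, through which `IsArchSmooth` is defined
open scoped Matrix.Norms.Operator

/-- **The `K_∞`-slices of `z φ`, for a central word `z`, lie in any subspace `M` of functions on `K_∞`
containing the `K_∞`-slices `k ↦ φ (x k)` of the `K_∞`-finite smooth function `φ`** (no stability
of `M` needed). Proof: `(z φ)(g k) = (r(k) (z φ))(g) = (z (r(k) φ))(g)` (central words commute with the
right `K_∞`-translations, `applyFree_archTranslate_of_isCentralWord`), and `ψ ↦ (z ψ)(g)` is a
linear functional on the finite-dimensional span `E_φ` of the `K_∞`-translates of `φ`, hence a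
finite combination `∑ᵢ cᵢ ev_{xᵢ}` of evaluations (`exists_finsupp_eval_eq`); so the slice of `z φ`
at `g` is `∑ᵢ cᵢ · (k ↦ φ (xᵢ k)) ∈ M`. This is the `K_∞`-type bookkeeping in Harish-Chandra's
finiteness theorem (`Z(𝔤)` preserves `𝒜(U, J) ∩ (K_∞`-types`)`), Borel–Jacquet 1979, 4.3 (i)–(ii).
[cite: BorelJacquet1979, 4.3 (ii)] -/
theorem slice_applyFree_mem_of_isCentralWord (M : Submodule ℂ (Kinf n K → ℂ))
    {φ : (AdelicGroupData.gl n K).Adelic → ℂ} (hφs : IsArchSmooth (AutomorphyDatum.gl n K hcpt).ofArch φ)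
    (hφK : IsKFinite (AutomorphyDatum.gl n K hcpt).ofArch φ)
    (hφM : ∀ g, (fun k : Kinf n K => φ (g * (AutomorphyDatum.gl n K hcpt).ofK k)) ∈ M)
    {p : FreeAlgebra ℝ (archGroupGL n K).lie} (hp : IsCentralWord p)
    (g : (AdelicGroupData.gl n K).Adelic) :
    (fun k : Kinf n K =>
      applyFree (AutomorphyDatum.gl n K hcpt).ofArch p φ (g * (AutomorphyDatum.gl n K hcpt).ofK k)) ∈ M := by
  have hH : (AutomorphyDatum.gl n K hcpt).arch.lie = ⊤ := archGroupGL_lie n K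
  have hc : (AutomorphyDatum.gl n K hcpt).arch.carrier = ⊤ := archGroupGL_carrier n K
  -- the span of the `K_∞`-translates of `φ`: finite-dimensional, smooth
  set E := kTranslateSpan (AutomorphyDatum.gl n K hcpt).ofArch φ with hE_def
  haveI : FiniteDimensional ℂ E := hφK
  have hEsm : ∀ ψ ∈ E, IsArchSmooth (AutomorphyDatum.gl n K hcpt).ofArch ψ := by
    intro ψ hψ
    refine (Submodule.span_le (p := archSmooth (AutomorphyDatum.gl n K hcpt).ofArch)).2 ?_ hψ
    rintro _ ⟨k, rfl⟩
    exact isArchSmooth_archTranslate _ _ hφs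
  -- `ψ ↦ (p ψ)(g)`, a linear functional on `E`
  let Λ : Module.Dual ℂ E :=
    { toFun := fun ψ => applyFree (AutomorphyDatum.gl n K hcpt).ofArch p (ψ : (AdelicGroupData.gl n K).Adelic → ℂ) g
      map_add' := fun ψ ψ' => by
        rw [Submodule.coe_add, applyFree_add_right_of_top _ hH hc p (hEsm _ ψ.2) (hEsm _ ψ'.2), Pi.add_apply]
      map_smul' := fun c ψ => by
        rw [Submodule.coe_smul, applyFree_smul_right, Pi.smul_apply, RingHom.id_apply] }
  have hΛ : ∀ ψ : E, Λ ψ = applyFree (AutomorphyDatum.gl n K hcpt).ofArch p (ψ : (AdelicGroupData.gl n K).Adelic → ℂ) g :=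
    fun _ => rfl
  obtain ⟨c, hcΛ⟩ := exists_finsupp_eval_eq E Λ
  -- the translates `r(k) φ ∈ E`
  have hmem : ∀ k : Kinf n K,
      archTranslate (AutomorphyDatum.gl n K hcpt).ofArch
        (Subgroup.inclusion (AutomorphyDatum.gl n K hcpt).arch.maximalCompact_le_carrier k) φ ∈ E :=
    fun k => archTranslate_mem_kTranslateSpan _ k φ
  -- the slice of `p φ` at `g` is `∑ᵢ cᵢ` (slice of `φ` at `xᵢ`)
  have key : (fun k : Kinf n K =>
      applyFree (AutomorphyDatum.gl n K hcpt).ofArch p φ (g * (AutomorphyDatum.gl n K hcpt).ofK k)) =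
      c.sum fun x a => a • fun k : Kinf n K => φ (x * (AutomorphyDatum.gl n K hcpt).ofK k) := by
    funext k
    have h1 : applyFree (AutomorphyDatum.gl n K hcpt).ofArch p φ (g * (AutomorphyDatum.gl n K hcpt).ofK k) =
        Λ ⟨_, hmem k⟩ :=
      (congrFun (applyFree_archTranslate_of_isCentralWord (AutomorphyDatum.gl n K hcpt).ofArch hH hc
        (Subgroup.inclusion (AutomorphyDatum.gl n K hcpt).arch.maximalCompact_le_carrier k) hp hφs) g).symm
    rw [h1, hcΛ ⟨_, hmem k⟩, Finsupp.sum, Finsupp.sum, Finset.sum_apply]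
    exact Finset.sum_congr rfl fun x _ => rfl
  rw [key, Finsupp.sum]
  exact M.sum_mem fun x _ => M.smul_mem _ (hφM x)

end Slices

/-! ### 3. The ideal form from the character form -/

section Main

variable {n : ℕ} {K : Type} [Field K] [NumberField K] {hcpt : isCompact_glFiniteIntegralLevel n K}

-- the scoped operator norm on `𝔤𝔩_n(K_∞)`, through which `IsArchSmooth` is defined
open scoped Matrix.Norms.Operator

set_option maxHeartbeats 1600000 in
/-- **Harish-Chandra's finiteness theorem for `GL_n / K`: the ideal form follows from the character
form** (`harishChandra_finiteness_gl hcpt → harishChandra_finiteness hcpt`). Let `U` be a level, `J ≤ Z(𝔤)`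
an ideal of finite codimension and `M` a finite-dimensional right-`K_∞`-stable space of functions on
`K_∞`; let `S_J` be the set of automorphic forms of level `U` killed by (the central words with image
in) `J` with all `K_∞`-slices in `M`, and `F` its span inside the smooth functions `E`, on which `Z(𝔤)`
acts through `envelopingAction (lieDerivRep)`. Then `F` is `Z(𝔤)`-stable — central words preserve
automorphy (Borel–Jacquet 4.3 (ii), `isStableSubmodule_automorphicForms_gl`), the level, the
annihilation by `J` (central words commute) and the slice condition
(`slice_applyFree_mem_of_isCentralWord`) — and killed by `J`; and a subspace of `F` on which `Z(𝔤)`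
acts through a character `θ` consists of automorphic forms of level `U`, `Z(𝔤)`-character `θ` and
slices in `M`, so it is finite-dimensional by the character form. By
`finiteDimensional_of_forall_character` (the basis of `Z(𝔤) ⧸ J` acts by commuting algebraic
operators; joint eigenspaces are character subspaces) `F` is finite-dimensional. Harish-Chandra
1968, §2; Borel–Jacquet 1979, 4.3 (i). [cite: BorelJacquet1979, 4.3 (i)] -/
theorem harishChandra_finiteness_of_harishChandra_finiteness_gl (h : harishChandra_finiteness_gl hcpt) :
    harishChandra_finiteness hcpt := by
  intro U hU J hJ M _ hM
  have hH : (AutomorphyDatum.gl n K hcpt).arch.lie = ⊤ := archGroupGL_lie n K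
  have hc : (AutomorphyDatum.gl n K hcpt).arch.carrier = ⊤ := archGroupGL_carrier n K
  -- the generating set
  set S : Set ((AdelicGroupData.gl n K).Adelic → ℂ) :=
    {φ : (AdelicGroupData.gl n K).Adelic → ℂ |
      IsAutomorphicForm (AutomorphyDatum.gl n K hcpt) φ ∧
      IsRightInvariantUnder U φ ∧
      (∀ (p : FreeAlgebra ℝ (archGroupGL n K).lie) (hp : IsCentralWord p),
        (⟨freeToEnveloping (archGroupGL n K) p, hp⟩ : centerU (archGroupGL n K)) ∈ J →
          applyFree (AutomorphyDatum.gl n K hcpt).ofArch p φ = 0) ∧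
      ∀ g : (AdelicGroupData.gl n K).Adelic,
        (fun k : Kinf n K => φ (g * (AutomorphyDatum.gl n K hcpt).ofK k)) ∈ M} with hS_def
  change FiniteDimensional ℂ (Submodule.span ℂ S)
  -- the ambient space of smooth functions and the action of `Z(𝔤)` on it
  set E : Submodule ℂ ((AdelicGroupData.gl n K).Adelic → ℂ) := archSmooth (AutomorphyDatum.gl n K hcpt).ofArch
    with hE_def
  have hSE : S ⊆ E := fun φ hφ => hφ.1.archSmooth
  have hspanE : Submodule.span ℂ S ≤ E := Submodule.span_le.2 hSE
  have hsm : ∀ ψ ∈ Submodule.span ℂ S, IsArchSmooth (AutomorphyDatum.gl n K hcpt).ofArch ψ := fun ψ hψ => hspanE hψ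
  set ρ := lieDerivRep (AutomorphyDatum.gl n K hcpt).ofArch hH hc with hρ_def
  set T : centerU (archGroupGL n K) →ₐ[ℝ] Module.End ℂ E :=
    (envelopingAction ρ).comp (centerU (archGroupGL n K)).val with hT_def
  have hTapply : ∀ (p : FreeAlgebra ℝ (archGroupGL n K).lie) (hp : IsCentralWord p) (x : E),
      ((T ⟨freeToEnveloping (archGroupGL n K) p, hp⟩ x : E) : (AdelicGroupData.gl n K).Adelic → ℂ) =
        applyFree (AutomorphyDatum.gl n K hcpt).ofArch p x :=
    fun p hp x => coe_envelopingAction_freeToEnveloping hH hc p x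
  have hTword : ∀ (z : centerU (archGroupGL n K)), ∃ (p : FreeAlgebra ℝ (archGroupGL n K).lie)
      (hp : IsCentralWord p), (⟨freeToEnveloping (archGroupGL n K) p, hp⟩ : centerU (archGroupGL n K)) = z := by
    intro z
    obtain ⟨p, hp⟩ := freeToEnveloping_surjective (archGroupGL n K) (z : UniversalEnvelopingAlgebra ℝ (archGroupGL n K).lie)
    have hpc : IsCentralWord p := by
      show freeToEnveloping (archGroupGL n K) p ∈ centerU (archGroupGL n K)
      rw [hp]
      exact z.2
    exact ⟨p, hpc, Subtype.ext hp⟩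
  set F : Submodule ℂ E := (Submodule.span ℂ S).comap E.subtype with hF_def
  have hF : ∀ x : E, x ∈ F ↔ (x : (AdelicGroupData.gl n K).Adelic → ℂ) ∈ Submodule.span ℂ S := fun x => Iff.rfl
  -- `S` is stable under central words
  have hSstab : ∀ (p : FreeAlgebra ℝ (archGroupGL n K).lie), IsCentralWord p → ∀ φ ∈ S,
      applyFree (AutomorphyDatum.gl n K hcpt).ofArch p φ ∈ S := by
    rintro p hp φ ⟨hφ, hφU, hφJ, hφM⟩
    refine ⟨?_, hφU.applyFree_gl hU p, fun q hq hqJ => ?_, fun g =>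
      slice_applyFree_mem_of_isCentralWord M hφ.archSmooth hφ.kFinite hφM hp g⟩
    · exact isAutomorphicForm_of_mem_automorphicForms_gl
        ((isStableSubmodule_automorphicForms_gl hcpt).applyFree_mem p hφ.mem_automorphicForms)
    · -- `q (p φ) = (q p) φ = (p q) φ = p (q φ) = 0`
      have hcomm : freeToEnveloping (archGroupGL n K) (q * p) = freeToEnveloping (archGroupGL n K) (p * q) := by
        rw [map_mul, map_mul]
        exact (Subalgebra.mem_center_iff.1 hq _).symm
      have e1 : applyFree (AutomorphyDatum.gl n K hcpt).ofArch q (applyFree (AutomorphyDatum.gl n K hcpt).ofArch p φ) =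
          applyFree (AutomorphyDatum.gl n K hcpt).ofArch (q * p) φ :=
        (applyFree_mul_of_isArchSmooth hφ.archSmooth q p).symm
      have e2 : applyFree (AutomorphyDatum.gl n K hcpt).ofArch (q * p) φ =
          applyFree (AutomorphyDatum.gl n K hcpt).ofArch (p * q) φ :=
        applyFree_congr_gl hcpt hcomm hφ.archSmooth
      have e3 : applyFree (AutomorphyDatum.gl n K hcpt).ofArch (p * q) φ =
          applyFree (AutomorphyDatum.gl n K hcpt).ofArch p (applyFree (AutomorphyDatum.gl n K hcpt).ofArch q φ) :=
        applyFree_mul_of_isArchSmooth hφ.archSmooth p q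
      rw [e1, e2, e3, hφJ q hq hqJ, applyFree_zero_right]
  -- hence so is its span
  have hspanstab : ∀ (p : FreeAlgebra ℝ (archGroupGL n K).lie), IsCentralWord p → ∀ ψ ∈ Submodule.span ℂ S,
      applyFree (AutomorphyDatum.gl n K hcpt).ofArch p ψ ∈ Submodule.span ℂ S := by
    intro p hp ψ hψ
    induction hψ using Submodule.span_induction with
    | mem ψ hψS => exact Submodule.subset_span (hSstab p hp ψ hψS)
    | zero =>
      rw [applyFree_zero_right]
      exact Submodule.zero_mem _
    | add ψ ψ' hψ hψ' h₁ h₂ =>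
      rw [applyFree_add_right_of_top _ hH hc p (hsm ψ hψ) (hsm ψ' hψ')]
      exact Submodule.add_mem _ h₁ h₂
    | smul c ψ _ h₁ =>
      rw [applyFree_smul_right]
      exact Submodule.smul_mem _ c h₁
  -- and the span is killed by `J`
  have hspanJ : ∀ (p : FreeAlgebra ℝ (archGroupGL n K).lie) (hp : IsCentralWord p),
      (⟨freeToEnveloping (archGroupGL n K) p, hp⟩ : centerU (archGroupGL n K)) ∈ J →
        ∀ ψ ∈ Submodule.span ℂ S, applyFree (AutomorphyDatum.gl n K hcpt).ofArch p ψ = 0 := by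
    intro p hp hpJ ψ hψ
    induction hψ using Submodule.span_induction with
    | mem ψ hψS => exact hψS.2.2.1 p hp hpJ
    | zero => exact applyFree_zero_right _ p
    | add ψ ψ' hψ hψ' h₁ h₂ =>
      rw [applyFree_add_right_of_top _ hH hc p (hsm ψ hψ) (hsm ψ' hψ'), h₁, h₂, add_zero]
    | smul c ψ _ h₁ => rw [applyFree_smul_right, h₁, smul_zero]
  -- the level and slice conditions pass to the span
  have hspanU : ∀ ψ ∈ Submodule.span ℂ S, IsRightInvariantUnder U ψ := by
    intro ψ hψ
    induction hψ using Submodule.span_induction with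
    | mem ψ hψS => exact hψS.2.1
    | zero => exact fun _ _ _ => rfl
    | add _ _ _ _ h₁ h₂ => exact fun u hu g => by simp only [Pi.add_apply, h₁ u hu g, h₂ u hu g]
    | smul c _ _ h₁ => exact fun u hu g => by simp only [Pi.smul_apply, h₁ u hu g]
  have hspanM : ∀ ψ ∈ Submodule.span ℂ S, ∀ g : (AdelicGroupData.gl n K).Adelic,
      (fun k : Kinf n K => ψ (g * (AutomorphyDatum.gl n K hcpt).ofK k)) ∈ M := by
    intro ψ hψ g
    induction hψ using Submodule.span_induction with
    | mem ψ hψS => exact hψS.2.2.2 g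
    | zero => exact M.zero_mem
    | add _ _ _ _ h₁ h₂ => exact M.add_mem h₁ h₂
    | smul c _ _ h₁ => exact M.smul_mem c h₁
  -- (i) `F` is `Z(𝔤)`-stable
  have hFT : ∀ z, ∀ x ∈ F, T z x ∈ F := by
    intro z x hx
    obtain ⟨p, hp, rfl⟩ := hTword z
    rw [hF, hTapply p hp x]
    exact hspanstab p hp _ ((hF x).1 hx)
  -- (ii) `F` is killed by `J`
  have hFJ : ∀ z ∈ J, ∀ x ∈ F, T z x = 0 := by
    intro z hz x hx
    obtain ⟨p, hp, rfl⟩ := hTword z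
    apply Subtype.ext
    rw [hTapply p hp x, Submodule.coe_zero]
    exact hspanJ p hp hz _ ((hF x).1 hx)
  -- (iii) character subspaces of `F` are finite-dimensional, by the character form
  have hchar : ∀ F' : Submodule ℂ E, F' ≤ F → ∀ θ : centerU (archGroupGL n K) →ₐ[ℝ] ℂ,
      (∀ z, ∀ x ∈ F', T z x = θ z • x) → FiniteDimensional ℂ F' := by
    intro F' hF' θ hθ
    have hfin := h hU θ M hM
    have hle : F'.map E.subtype ≤ Submodule.span ℂ
        {φ : (AdelicGroupData.gl n K).Adelic → ℂ | IsAutomorphicForm (AutomorphyDatum.gl n K hcpt) φ ∧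
          IsRightInvariantUnder U φ ∧ HasZCharacter (AutomorphyDatum.gl n K hcpt).ofArch φ θ ∧
            ∀ g : (AdelicGroupData.gl n K).Adelic,
              (fun k : Kinf n K => φ (g * (AutomorphyDatum.gl n K hcpt).ofK k)) ∈ M} := by
      rintro _ ⟨x, hx, rfl⟩
      have hxS : (x : (AdelicGroupData.gl n K).Adelic → ℂ) ∈ Submodule.span ℂ S := (hF x).1 (hF' hx)
      refine Submodule.subset_span ⟨?_, ?_, fun p hp => ?_, ?_⟩
      · -- automorphic: the span of automorphic forms consists of automorphic forms
        have hle : Submodule.span ℂ S ≤ automorphicForms (AutomorphyDatum.gl n K hcpt) :=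
          Submodule.span_le.2 fun φ hφ => hφ.1.mem_automorphicForms
        exact isAutomorphicForm_of_mem_automorphicForms_gl (hle hxS)
      · -- level
        exact hspanU _ hxS
      · -- the character
        have key := hθ ⟨freeToEnveloping (archGroupGL n K) p, hp⟩ x hx
        have key' : ((T ⟨freeToEnveloping (archGroupGL n K) p, hp⟩ x : E) : (AdelicGroupData.gl n K).Adelic → ℂ) =
            ((θ ⟨freeToEnveloping (archGroupGL n K) p, hp⟩ • x : E) : (AdelicGroupData.gl n K).Adelic → ℂ) :=
          congrArg Subtype.val key
        exact (hTapply p hp x).symm.trans key'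
      · -- slices
        exact hspanM _ hxS
    haveI : FiniteDimensional ℂ (F'.map E.subtype) := Submodule.finiteDimensional_of_le hle
    exact Module.Finite.equiv (Submodule.equivMapOfInjective E.subtype Subtype.val_injective F').symm
  -- conclusion
  haveI : FiniteDimensional ℂ F := finiteDimensional_of_forall_character T J hJ F hFT hFJ hchar
  exact Module.Finite.equiv (Submodule.comapSubtypeEquivOfLe hspanE)

/-- **The two forms of Harish-Chandra's finiteness theorem for `GL_n / K` are equivalent**: the ideal
form `harishChandra_finiteness hcpt` (`LangAutomorphicForms`) and the character form
`harishChandra_finiteness_gl hcpt` (`AutomorphicRepsGL`) of Borel–Jacquet 1979, 4.3 (i)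
(`harishChandra_finiteness_gl_of_harishChandra_finiteness` and
`harishChandra_finiteness_of_harishChandra_finiteness_gl`). [cite: BorelJacquet1979, 4.3 (i)] -/
theorem harishChandra_finiteness_iff_harishChandra_finiteness_gl :
    harishChandra_finiteness hcpt ↔ harishChandra_finiteness_gl hcpt :=
  ⟨harishChandra_finiteness_gl_of_harishChandra_finiteness, harishChandra_finiteness_of_harishChandra_finiteness_gl⟩

end Main

end Literature.NumberTheory.Automorphic
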